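import Mathlib
import Summits.Ventures.PercRepro2.Defs

/-!
# Count inequalities from injections (blind cell PercRepro2, p3 g42, 2026-08-30;
`proofs/P3-POCKETRK.md` §10⁶ (e): the bridge for the F-count inequalities)

The four count hypotheses of `hdK_nonpos_of_cluster_rsd` are sums of indicators over the cluster
colourings.  An injection `Φ` from the indices satisfying `P` into those satisfying `Q` gives
`Σ_i [P i] ≤ Σ_i [Q i]` (`sum_indicator_le_of_injOn_p3`), and two injections with disjoint
images give `Σ_i [P₁ i] + Σ_i [P₂ i] ≤ Σ_i [Q i]` (`sum_indicator_add_le_of_injOn_p3`) — the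
forms (C1_δ) and (C2_δ) with `Φ₁`, `Φ₀` of §10⁶ (e).  Own work; std axioms.
-/

namespace Summit.Ventures.PercRepro2

namespace NoPocket

open Finset Classical

variable {ι : Type*} [Fintype ι]

/-- A sum of indicators is the cardinality of the filter. -/
lemma sum_indicator_eq_card_p3 (P : ι → Prop) :
    (∑ i, if P i then (1 : ℤ) else 0) = ((univ.filter fun i => P i).card : ℤ) := by
  rw [Finset.card_filter]
  push_cast
  rfl

/-- **An injection from `P` into `Q` bounds the indicator sums.** -/
theorem sum_indicator_le_of_injOn_p3 (P Q : ι → Prop) (Φ : ι → ι) (hmaps : ∀ i, P i → Q (Φ i))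
    (hinj : Set.InjOn Φ {i | P i}) :
    (∑ i, if P i then (1 : ℤ) else 0) ≤ ∑ i, if Q i then (1 : ℤ) else 0 := by
  rw [sum_indicator_eq_card_p3, sum_indicator_eq_card_p3]
  exact_mod_cast Finset.card_le_card_of_injOn Φ
    (fun i hi => by
      rw [Finset.mem_coe, Finset.mem_filter] at hi ⊢
      exact ⟨Finset.mem_univ _, hmaps i hi.2⟩)
    (fun i hi j hj hij => hinj (by simpa using hi) (by simpa using hj) hij)

/-- **Two injections with disjoint images bound the sum of two indicator sums.** -/
theorem sum_indicator_add_le_of_injOn_p3 (P₁ P₂ Q : ι → Prop) (Φ₁ Φ₂ : ι → ι)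
    (h1 : ∀ i, P₁ i → Q (Φ₁ i)) (h2 : ∀ i, P₂ i → Q (Φ₂ i))
    (hinj1 : Set.InjOn Φ₁ {i | P₁ i}) (hinj2 : Set.InjOn Φ₂ {i | P₂ i})
    (hdisj : ∀ i j, P₁ i → P₂ j → Φ₁ i ≠ Φ₂ j) :
    (∑ i, if P₁ i then (1 : ℤ) else 0) + (∑ i, if P₂ i then (1 : ℤ) else 0) ≤
      ∑ i, if Q i then (1 : ℤ) else 0 := by
  -- the images are disjoint subsets of the `Q`-filter
  rw [sum_indicator_eq_card_p3, sum_indicator_eq_card_p3, sum_indicator_eq_card_p3]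
  have hc1 : (univ.filter fun i => P₁ i).card = ((univ.filter fun i => P₁ i).image Φ₁).card :=
    (Finset.card_image_of_injOn (fun i hi j hj hij =>
      hinj1 (by simpa using hi) (by simpa using hj) hij)).symm
  have hc2 : (univ.filter fun i => P₂ i).card = ((univ.filter fun i => P₂ i).image Φ₂).card :=
    (Finset.card_image_of_injOn (fun i hi j hj hij =>
      hinj2 (by simpa using hi) (by simpa using hj) hij)).symm
  have hsub : ((univ.filter fun i => P₁ i).image Φ₁) ∪ ((univ.filter fun i => P₂ i).image Φ₂) ⊆
      univ.filter fun i => Q i := by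
    intro x hx
    rw [Finset.mem_union, Finset.mem_image, Finset.mem_image] at hx
    rw [Finset.mem_filter]
    refine ⟨Finset.mem_univ _, ?_⟩
    rcases hx with ⟨i, hi, rfl⟩ | ⟨i, hi, rfl⟩
    · exact h1 i (Finset.mem_filter.1 hi).2
    · exact h2 i (Finset.mem_filter.1 hi).2
  have hdis : Disjoint ((univ.filter fun i => P₁ i).image Φ₁)
      ((univ.filter fun i => P₂ i).image Φ₂) := by
    rw [Finset.disjoint_left]
    intro x hx1 hx2
    rw [Finset.mem_image] at hx1 hx2
    obtain ⟨i, hi, rfl⟩ := hx1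
    obtain ⟨j, hj, hij⟩ := hx2
    exact hdisj i j (Finset.mem_filter.1 hi).2 (Finset.mem_filter.1 hj).2 hij.symm
  have := Finset.card_le_card hsub
  rw [Finset.card_union_of_disjoint hdis] at this
  rw [hc1, hc2]
  exact_mod_cast this

end NoPocket

end Summit.Ventures.PercRepro2
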